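import Summits.ValiantsHypothesis.ValiantsHypothesis.Theorems.VPBoundarySquareUniformCoverConverse
import Summits.ValiantsHypothesis.ValiantsHypothesis.Theorems.VPBoundarySquareCHAlgebraicHalf
import HarnessLib

/-!
# VPBoundarySquare — the summit through the finite-level residual (NODE v11 booking)

With `chClosureDefinable_iff_uniformCHCover` (T5/T5c) the route's P-side residual `U_CH` is
replaced, in the kernel, by the finite-level statement `∀ d, UniformCHCover d` («for every budget,
ONE counting-hierarchy language and ONE constant chart every border point at every large level,
the chart being chosen by polynomial advice»). This file records the summit-facing compositions:

* `collapseEmptiesBoundary_of_ERH_of_uniformCHCover : ERH → (∀ d, UniformCHCover d) → CollapseEmptiesBoundary`;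
* `valiant_of_ERH_of_Q_of_uniformCHCover : ERH → EmptyBoundarySeparates → (∀ d, UniformCHCover d) → ValiantsHypothesis`;
* the refuter-facing contrapositive on the P-side: under `ERH`, a failure of the attacked piece
  `CollapseEmptiesBoundary` forces a budget `d` whose border escapes every `CH`-datum infinitely often.

References: `Burgisser2026HNC` Def. 4.1–4.2, Cor. 4.12; the route file `Theses/VPBoundarySquare.lean`.
-/

noncomputable section

set_option linter.dupNamespace false

open Literature.Computability.AlgebraicComplexity Literature.Computability.Complexity
open Literature.NumberTheory.LFunctions (ExtendedRiemannHypothesis)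

open Summit.ValiantsHypothesis.ValiantsHypothesis.Theses.VPBoundarySquare
open Summit.ValiantsHypothesis.ValiantsHypothesis.Theorems.VPBoundarySquareUniformCover
open Summit.ValiantsHypothesis.ValiantsHypothesis.Theorems.VPBoundarySquareUniformCoverConverse
open Summit.ValiantsHypothesis.ValiantsHypothesis.Theorems.VPBoundarySquareCHAlgebraicHalf

namespace Summit.ValiantsHypothesis.ValiantsHypothesis.Theorems.VPBoundarySquareUniformCoverSummit

/-- **The attacked piece from the finite-level residual (mod ERH).** [cite: Burgisser2026HNC, Cor. 4.12] -/
theorem collapseEmptiesBoundary_of_ERH_of_uniformCHCover (hGRH : ExtendedRiemannHypothesis)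
    (hcov : ∀ d, UniformCHCover d) : CollapseEmptiesBoundary :=
  collapseEmptiesBoundary_of_ERH_of_chClosureDefinable hGRH (chClosureDefinable_of_uniformCHCover hcov)

/-- **The summit from the floor residual `Q`, the finite-level cover and ERH.**
[cite: Burgisser2026HNC, Cor. 4.12] -/
theorem valiant_of_ERH_of_Q_of_uniformCHCover (hGRH : ExtendedRiemannHypothesis)
    (hQ : EmptyBoundarySeparates) (hcov : ∀ d, UniformCHCover d) : ValiantsHypothesis :=
  valiant_of_ERH_of_Q_of_chClosureDefinable hGRH hQ (chClosureDefinable_of_uniformCHCover hcov)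

/-- **Refuter-facing form on the P-side (mod ERH).** If the attacked piece fails, some budget `d`
is not uniformly `CH`-covered: for every `L' ∈ CH` and all constants, border points of budget `d`
escaping every chart of `(L', c)` occur at levels beyond any bound. [cite: Burgisser2026HNC, Def. 4.1-4.2 (p. 11)] -/
theorem exists_budget_not_uniformCHCover_of_ERH_of_not_collapseEmptiesBoundary
    (hGRH : ExtendedRiemannHypothesis) (h : ¬ CollapseEmptiesBoundary) :
    ∃ d : ℕ, ∀ L' ∈ CH, ∀ c N : ℕ, ∃ n, N ≤ n ∧ ∃ (u : ℕ) (g : MvPolynomial (Fin u) ℂ),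
      IsBorderPoint d n g ∧ ¬ Covered L' c n g := by
  by_contra hneg
  refine h (collapseEmptiesBoundary_of_ERH_of_uniformCHCover hGRH fun d => ?_)
  by_contra hd
  refine hneg ⟨d, fun L' hL' c N => ?_⟩
  by_contra hesc
  refine hd ⟨L', hL', c, N, fun n hn u g hg => ?_⟩
  by_contra hcov
  exact hesc ⟨n, hn, u, g, hg, hcov⟩

end Summit.ValiantsHypothesis.ValiantsHypothesis.Theorems.VPBoundarySquareUniformCoverSummit
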